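import Summits.BirchSwinnertonDyer.Rank1Residual.AdditivePotMult.Twist
import Literature.NumberTheory.EllipticCurves.Milne1972.WeilRestrictionQuadraticBSDQuotient
import Literature.NumberTheory.EllipticCurves.Skinner2016.RankZeroPPart
import Literature.NumberTheory.EllipticCurves.Rank1Residual.PrintShape
import Literature.NumberTheory.EllipticCurves.Rank1Residual.Typed.X2
import Literature.NumberTheory.EllipticCurves.AnalyticRankOrderProofs
import HarnessLib

/-!
# X3♯(M) / X4(M): the CLASS THEOREMS of the base-change-and-descend route, and the located gap

HONEST FRAMING (cell `b2b-bsdres`, run/shared/lean/b2b/bsd-rank1-residual/, verbatim in every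
file): the goal of the cell is to DELETE the COMBINATION-SHAPED residual classes of the
Birch–Swinnerton-Dyer formula for ALL analytic-rank `≤ 1` elliptic curves over `ℚ` — "full BSD
formula for every rank `≤ 1` curve in class `C`" assembled STRICTLY from published theorems — so
that the rank-`≤ 1` remainder becomes exactly the CONSTRUCTION-SHAPED classes, which are TYPED
(missing-input `Prop`s), NOT attempted. This is not "finishing BSD". Sub-cell
`b2b-bsdres-additive-p1` (CLASS-OWNERS row "X3/X4 additive — pot. multiplicative / X3♯(M)"); a
RESEARCH ROUTE, no claim beyond the stated sub-classes; X3♯(M) and X4(M) REMAIN CONSTRUCTION-SHAPED.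

Theorems only. Shape of every theorem: "`BSD_p` for `(E, p)` in sub-class `S` ⇐ [Milne's
Weil-restriction theorem, Literature named fact `Milne1972.bsdQuotient_baseChange_quadratic`] ∧
[descent lemma, kernel: `bsdp_of_pPartOver_of_bsdp_twist`] ∧ [TYPED over-`K` input
`MissingPPartOverAt`] ∧ [what the partition says about the `p`-MULTIPLICATIVE twist `E^{(d_K)}`]",
with the cell's standing named facts (Gross–Zagier–Kolyvagin `hGZK`, modularity `hmod`). The twist
datum is explicit: a quadratic field `K` (`[K:ℚ] = 2`, discriminant `D`), a globally minimal model
`Wd` of `E^{(D)}` that is MULTIPLICATIVE at `p` (such `D` exist for every pot-mult pair: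
`PotMult.exists_twist_mult`, and then every `D' ∈ D·ℚ^{×2}`-class field works), and a globally
minimal `K`-model `W'` of `E_K` (exists iff the prime of `K` above `p` — the only place where
`W ⊗ K` is not minimal — is principal, e.g. `K = ℚ(√p*)`; recorded, not used).

* `bsdp_of_pPartOver_of_bsdp_twist'` — the descent theorem with Milne's identity DISCHARGED from
  the Literature fact: `BSD(E,p) ⇐ MissingPPartOverAt(E_K, p) ∧ BSD(E^{(D)}, p)`, any prime `p`,
  `E`, `E^{(D)}` of analytic rank `≤ 1`.
* `bsdp_twist_of_rankZero_ram` — the twist side is COVERED when `L(E^{(D)},1) ≠ 0`, `E^{(D)}[p]`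
  irreducible and (ram): Skinner, Pacific J. Math. 283 (2016) Thm. C (cell named fact
  `Skinner2016.thmC_padicValRat_bsd_rank_zero`, `p ≥ 3`, good-ordinary-or-multiplicative).
* `bsdp_of_classX4M_of_rankZero_twist` — **X4(M)⁰ := X4(M) ∧ [the multiplicative twist `E^{(D)}`
  has `L(E^{(D)},1) ≠ 0` and (ram)]: `BSD(E,p) ⇐ MissingPPartOverAt(E_K, p)` ALONE** (plus Milne,
  Skinner 2016 Thm. C, GZK, modularity — all published). This is the sharpest conversion: on X4(M)⁰
  the ENTIRE missing input is the `p`-part of BSD for ONE curve over ONE quadratic field at a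
  multiplicative prime of ramification index `2`. Existence of such `D` for a given pair: the sign
  of `E^{(D)}` is constant on `{D : p ∣ D}` ∩ (fixed local classes at `N∞`) and both signs occur, so
  Friedberg–Hoffstein (Ann. of Math. 142 (1995) Thm. B) / Bump–Friedberg–Hoffstein / Waldspurger give
  infinitely many `D` with `L(E^{(D)},1) ≠ 0`; (ram) for `E^{(D)}` needs a prime `q ≠ p` of `E` that
  is multiplicative or potentially multiplicative with `p ∤ ord_q(j)` (twisting by `q ∣ D` turns
  `I_n^*` into `I_n`) — a per-pair census bit (HOME report), NOT asserted here.
* `bsdp_of_classX3M_of_twist` — **X3♯(M): `BSD(E,p) ⇐ MissingPPartOverAt(E_K,p) ∧ X2.MissingInputAt(E^{(D)},p)`**: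
  the twist of an X3♯(M) pair is an X2 pair (`classX2_twist_of_classX3M`), whose typed input is the
  cell's `Typed.X2.MissingInputAt` (rank 0: the lower bound, Wuthrich Prop. 21 giving the upper;
  rank 1: the whole `p`-part). Two construction-shaped inputs: an honest RELOCATION, no deletion.

THE LOCATED GAP (presearch 2026-08-19; corpus fts + vec, galaxy; HOME/b2b-bsdres-additive-p1/REPORT.md):
`MissingPPartOverAt W' p` for `E_K`, `K = ℚ(√D)`, `p ∣ D`, at the MULTIPLICATIVE prime `𝔭 = (p, √D)`,
`e(𝔭|p) = 2`. Not reached by: Wan, Forum Math. Sigma 3 (2015) e18 (§1.1 "p is unramified [in F]";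
Thm. 7 good ordinary; one divisibility only over `F ≠ ℚ`); Disegni, ANT 9 (2015) Thm. 3 (good
ordinary, principal primes above `p`, conditional on the cyclotomic IMC over `F`) / Thm. 4 (CM,
`p ∤ D_F`); Disegni, Compositio 153 (2017) §1.5 (CM, one divisibility); Heegner/BDP `p`-part results
over imaginary quadratic `K` (need `p` split); Skinner–Urban 2014 Thm. 3.6.4 / Skinner 2016 (the
`ℤ_p`-cyclotomic branch over `ℚ` only). Equivalent formulation over `ℚ` (Delbourgo, Compositio 113
(1998): hypothesis (M), Thm. 2 = the bounded measure, Thm. 3 + Prop. 4 = rank-0 algebraic leading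
term at non-split `𝔭`, "Main Conjecture" p. 151 OPEN): the `ε = ω^{(p-1)/2}`-branch of the
cyclotomic main conjecture over `ℚ(μ_{p^∞})` for the `p`-multiplicative twist `E^{(p*)}`, with
control. That object is what a future theorem must supply; until then X3♯(M), X4(M) stay typed.
-/

noncomputable section

open scoped Classical

open WeierstrassCurve Literature.NumberTheory.EllipticCurves
  Literature.NumberTheory.EllipticCurves.Rank1Residual
  Literature.NumberTheory.EllipticCurves.Rank1Residual.Typed
  Literature.NumberTheory.EllipticCurves.Wuthrich2014

namespace Summit.BirchSwinnertonDyer.Rank1Residual.AdditivePotMult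

variable (W : WeierstrassCurve ℚ) [W.IsElliptic] [W.IsGloballyMinimal] (p : ℕ) [Fact p.Prime]
  (K : Type) [Field K] [NumberField K]
  (Wd : WeierstrassCurve ℚ) [Wd.IsElliptic] [Wd.IsGloballyMinimal]
  (W' : WeierstrassCurve K) [W'.IsElliptic] [W'.IsGloballyMinimal]

/-- **Descent theorem, Milne discharged.** For `W/ℚ` globally minimal of analytic rank `≤ 1`, a
quadratic field `K`, a globally minimal model `Wd` of `W^{(d_K)}` of analytic rank `≤ 1` and a
globally minimal `K`-model `W'` of `W_K`: `MissingPPartOverAt W' p ∧ BSD(Wd,p) ⟹ BSD(W,p)` — the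
Weil-restriction identity and the finiteness of `Ш(W'/K)` now come from the Literature named fact
`Milne1972.bsdQuotient_baseChange_quadratic` (`hMilne`; Milne 1972 Thm. 1 via Dokchitser–Dokchitser
2010 §2.1), the finiteness of `Ш(W)`, `Ш(Wd)` from Gross–Zagier–Kolyvagin (`hGZK`). [folklore] -/
theorem bsdp_of_pPartOver_of_bsdp_twist'
    (hGZK : rank_eq_analyticRank_of_analyticRank_le_one) (hmod : hasEntireLFunction_rat)
    (hMilne : Milne1972.bsdQuotient_baseChange_quadratic)
    (hr : W.analyticRank ≤ 1) (h2 : Module.finrank ℚ K = 2)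
    (hWd : ∃ C : VariableChange ℚ, C • W.quadraticTwist (NumberField.discr K : ℚ) = Wd)
    (hrd : Wd.analyticRank ≤ 1)
    (hW' : ∃ C : VariableChange K, C • W.baseChange K = W')
    (hK : MissingPPartOverAt W' p) (hd : BSDp Wd p) : BSDp W p := by
  obtain ⟨-, hfinW⟩ := hGZK W hr
  obtain ⟨-, hfinD⟩ := hGZK Wd hrd
  obtain ⟨hshaK, hWR⟩ := hMilne W K h2 Wd hWd W' hW' hfinW hfinD
  exact bsdp_of_pPartOver_of_bsdp_twist W p K Wd W' hGZK hmod hr h2 hWd hrd hW' hshaK hWR hK hd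

omit [W.IsElliptic] [W.IsGloballyMinimal] in
/-- **The twist side, COVERED in rank 0 with (ram)** (Skinner, Pacific J. Math. 283 (2016) Thm. C,
cell named fact `hSk`; `p ≥ 3`, multiplicative `p`, `E[p]` irreducible, a second multiplicative
prime `q ≠ p` with `p ∤ ord_q Δ_min`, `L(E,1) ≠ 0`): `BSD(Wd, p)` for a globally minimal `Wd` of
analytic rank `0` that is multiplicative at the odd prime `p` with `Irr` and `Ram`. Assembly as in
the cell's `bsdp_three_of_L_one_ne_zero_of_ram` (X10Proofs), at general `p`: the torsion term
vanishes under (irr) (`padicValNat_torsionOrder_eq_zero_of_irreducible`), then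
`bsdp_of_padicVal_printShape_rankZero`. [cite: Skinner2016PacificMC, Thm. C (§1), footnote 1, §2.5] -/
theorem bsdp_twist_of_rankZero_ram (hSk : Skinner2016.thmC_padicValRat_bsd_rank_zero)
    (hGZK : rank_eq_analyticRank_of_analyticRank_le_one) (hmod : hasEntireLFunction_rat)
    (hp : p ≠ 2) (hmult : Mult Wd p) (hirr : Irr Wd p) (hram : Ram Wd p)
    (hr0 : Wd.analyticRank = 0) : BSDp Wd p := by
  have hp3 : 3 ≤ p := by
    have h2 := (Fact.out : p.Prime).two_le
    omega
  have hL : Wd.entireLFunction 1 ≠ 0 := (Wd.analyticRank_eq_zero_iff_holds (hmod Wd)).mp hr0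
  obtain ⟨-, hfin⟩ := hGZK Wd (by rw [hr0]; exact zero_le_one)
  haveI : Finite Wd.sha := hfin
  obtain ⟨q, hq, hv⟩ := hSk Wd p hp3 (Or.inr hmult) hirr hram hL hfin
  refine bsdp_of_padicVal_printShape_rankZero Wd p hGZK hr0 hirr ⟨q, hq, ?_⟩
  rw [hv, padicValNat_torsionOrder_eq_zero_of_irreducible Wd p hirr]
  simp

/-- **X4(M)⁰ — the sharpest conversion.** For `(E,p) ∈ X4(M)` (odd additive `p`, `E[p]` irreducible,
`ord_p j < 0`) of analytic rank `≤ 1`, a quadratic field `K` whose twist `Wd ≅ E^{(d_K)}` is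
MULTIPLICATIVE at `p`, of analytic rank `0`, with (ram), and a globally minimal `K`-model `W'` of
`E_K`: **`BSD(E, p)` follows from the typed over-`K` input `MissingPPartOverAt W' p` ALONE**, the
other inputs being published theorems taken as the cell's named facts (Milne 1972 `hMilne`, Skinner
2016 Thm. C `hSk`, Gross–Zagier–Kolyvagin `hGZK`, modularity `hmod`): irreducibility passes to the
twist (`irr_iff_of_model_twist`), the twist is COVERED (`bsdp_twist_of_rankZero_ram`), and the
descent theorem applies. Nothing asserts that such `K` exists for a given pair (Friedberg–Hoffstein
for `L(E^{(D)},1) ≠ 0`; (ram) is a census bit) — see the module docstring. [folklore] -/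
theorem bsdp_of_classX4M_of_rankZero_twist
    (hGZK : rank_eq_analyticRank_of_analyticRank_le_one) (hmod : hasEntireLFunction_rat)
    (hMilne : Milne1972.bsdQuotient_baseChange_quadratic)
    (hSk : Skinner2016.thmC_padicValRat_bsd_rank_zero)
    (hX : ClassX4M W p) (hr : W.analyticRank ≤ 1) (h2 : Module.finrank ℚ K = 2)
    (hWd : ∃ C : VariableChange ℚ, C • W.quadraticTwist (NumberField.discr K : ℚ) = Wd)
    (hmult : Mult Wd p) (hram : Ram Wd p) (hr0 : Wd.analyticRank = 0)
    (hW' : ∃ C : VariableChange K, C • W.baseChange K = W')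
    (hK : MissingPPartOverAt W' p) : BSDp W p := by
  have hD : (NumberField.discr K : ℚ) ≠ 0 := by exact_mod_cast NumberField.discr_ne_zero K
  obtain ⟨hp2, -, hirrd⟩ := mult_irr_twist_of_classX4M hX hD hWd hmult
  have hd : BSDp Wd p := bsdp_twist_of_rankZero_ram p Wd hSk hGZK hmod hp2 hmult hirrd hram hr0
  exact bsdp_of_pPartOver_of_bsdp_twist' W p K Wd W' hGZK hmod hMilne hr h2 hWd
    (by rw [hr0]; exact zero_le_one) hW' hK hd

/-- **X3♯(M) — relocation to X2 + over-`K`.** For `(E,p) ∈ X3♯(M)` (odd additive Eisenstein `p`,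
`ord_p j < 0`) of analytic rank `≤ 1`, a quadratic field `K` whose twist `Wd ≅ E^{(d_K)}` is
MULTIPLICATIVE at `p` and of analytic rank `≤ 1`, and a globally minimal `K`-model `W'` of `E_K`:
`BSD(E,p)` follows from the typed over-`K` input `MissingPPartOverAt W' p` AND the cell's typed X2
input `Typed.X2.MissingInputAt Wd p` for the twist — which IS an X2 pair
(`classX2_twist_of_classX3M`) — via `Typed.X2.bsdp_of_missingInputAt` (Wuthrich 2014 Prop. 21 `hW`
for the rank-0 upper bound) and the descent theorem. Two construction-shaped inputs; honest
relocation, no deletion. [folklore] -/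
theorem bsdp_of_classX3M_of_twist
    (hGZK : rank_eq_analyticRank_of_analyticRank_le_one) (hmod : hasEntireLFunction_rat)
    (hMilne : Milne1972.bsdQuotient_baseChange_quadratic) (hW : sha_dvd_analyticSha)
    (hX : ClassX3M W p) (hr : W.analyticRank ≤ 1) (h2 : Module.finrank ℚ K = 2)
    (hWd : ∃ C : VariableChange ℚ, C • W.quadraticTwist (NumberField.discr K : ℚ) = Wd)
    (hmult : Mult Wd p) (hrd : Wd.analyticRank ≤ 1)
    (hW' : ∃ C : VariableChange K, C • W.baseChange K = W')
    (hK : MissingPPartOverAt W' p) (hX2 : X2.MissingInputAt Wd p) : BSDp W p := by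
  have hD : (NumberField.discr K : ℚ) ≠ 0 := by exact_mod_cast NumberField.discr_ne_zero K
  have hX2d : ClassX2 Wd p := classX2_twist_of_classX3M hX hD hWd hmult
  have hd : BSDp Wd p := X2.bsdp_of_missingInputAt hW hGZK hmod Wd p hrd hX2d hX2
  exact bsdp_of_pPartOver_of_bsdp_twist' W p K Wd W' hGZK hmod hMilne hr h2 hWd hrd hW' hK hd

/-! ### Appendix (2026-08-19, after the twist scan): X3♯(M) with a RANK-ZERO multiplicative twist

On the census the canonical twist `E^{(p*)}` of an X3♯(M) pair very often has analytic rank `0`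
(kit job j077723: 12/12 test pairs). Then the typed X2 input of the twist is only its LOWER-BOUND
half `MissingLowerBoundAt` (`ord_p #Ш_an(E^{(D)}) ≤ ord_p #Ш(E^{(D)})`): the upper bound at an odd
multiplicative prime with reducible `E^{(D)}[p]` is Wuthrich, Doc. Math. 19 (2014) Prop. 21, in
print (`Typed.X2.bsdp_of_missingInputAt`, rank-0 branch). -/

/-- **X3♯(M), rank-zero twist: `BSD(E,p) ⇐ MissingPPartOverAt(E_K,p) ∧ MissingLowerBoundAt(E^{(D)},p)`.**
As `bsdp_of_classX3M_of_twist`, with the twist `Wd` of analytic rank `0`: the X2 typed input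
`Typed.X2.MissingInputAt Wd p` reduces to `MissingLowerBoundAt Wd p` (its rank-1 clause is vacuous),
the opposite inequality being Wuthrich 2014 Prop. 21 (`hW`). So on X3♯(M)⁰ := X3♯(M) ∧ [the
`p`-multiplicative twist `E^{(d_K)}` has `L(E^{(d_K)},1) ≠ 0`] the relocated missing input is: the
`p`-part over `K` for `E_K` + ONE inequality ("Eisenstein-congruence" direction) for one
`p`-multiplicative Eisenstein curve over `ℚ`. Nothing asserted about either. [folklore] -/
theorem bsdp_of_classX3M_of_rankZero_twist
    (hGZK : rank_eq_analyticRank_of_analyticRank_le_one) (hmod : hasEntireLFunction_rat)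
    (hMilne : Milne1972.bsdQuotient_baseChange_quadratic) (hW : sha_dvd_analyticSha)
    (hX : ClassX3M W p) (hr : W.analyticRank ≤ 1) (h2 : Module.finrank ℚ K = 2)
    (hWd : ∃ C : VariableChange ℚ, C • W.quadraticTwist (NumberField.discr K : ℚ) = Wd)
    (hmult : Mult Wd p) (hr0 : Wd.analyticRank = 0)
    (hW' : ∃ C : VariableChange K, C • W.baseChange K = W')
    (hK : MissingPPartOverAt W' p) (hlow : MissingLowerBoundAt Wd p) : BSDp W p :=
  bsdp_of_classX3M_of_twist W p K Wd W' hGZK hmod hMilne hW hX hr h2 hWd hmult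
    (by rw [hr0]; exact zero_le_one) hW' hK
    ⟨fun _ => hlow, fun h1 => absurd (hr0.symm.trans h1) (by decide)⟩

end Summit.BirchSwinnertonDyer.Rank1Residual.AdditivePotMult

end
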